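import Summits.CriticalPhenomena.PercolationContinuityZ3.Theorems.FK.Transplant.FHBoundaryReach
import Summits.CriticalPhenomena.PercolationContinuityZ3.Theorems.FK.Transplant.FHDimension
import Literature.Probability.Percolation.GMSchemeStep
import HarnessLib

/-!
# FRONTIER TRANSPLANT, binder 1 (FH) calibration leaf XI — tools: the mid-plane net, the covering/first-exit step, the
# FKG transfer at a net point for the FREE box measure `fkLaw Λ_N (lattW p) q`, and recentring (Severo 2024, proof of Lemma 2.1)

Registered R122 (cell INBOX l.7779, 2026-08-26); registry row T1k; label T1k-A (coordinator fk-4 g234; the lead may restyle the label on its record line).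
Support file (`--supports stmt-CriticalPhenomena-4575`, helper) of the FRONTIER TRANSPLANT sub-cell (seat
`prim-bschramm-fkt-p2`); builds on p205010 (kernel theorem, internal audit signed; external expert review pending). TOOLS for
the leaf `Transplant/FHBulkReach.lean` (binder 1 IN THE BULK); 0 defs, 0 named facts, 0 sorries, standard axioms.

HONEST FRAMING (page 1, cell rule). The transplant's theorem of record `ufsc0_of_freeBoundaryHypothesis_r3` (p248245) is
CONDITIONAL on FH AND on TP_FK = `KNFreeTargetHittable d q p`, both OPEN at the same `p` for `q > 1` (⇔ GRC Conj. (5.103)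
via K1; barrier note `Literature.Barriers.CriticalPhenomena.SamePFreeBoundaryCriteria`, FBN-01, cited first; calibration
K1 verbatim: "[C3a ∀ p > p_c(q)] ∧ C3b ⇒ p̂_c(q) = p_c(q) = GRC Conj (5.103) = DT Question 5 (open for q ∈ (1,2))"); the
transplant is a typed reduction, not a proof of FK continuity. THIS FILE DOES NOT CHANGE THAT (NOT a discharge, NOT a
re-cut, NOT `_r4`; `_r3` « 2 / 0 ☑ », n_open = 2 unchanged).

CONTENTS (ambient lattice `ℤ^{d+1}`, vertical coordinate `0`; `φ⁰_{Λ_N,p,q} := fkLaw Λ_N (lattW p) q` = the FREE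
random-cluster measure of `Λ_N`, nothing wired, = tree `rcBoxLaw d false p q N`): §1 the mid-plane net `{x ∈ Λ_{N+ℓ} : x₀ = 0, (2ℓ+1) ∣ xᵢ (i ≥ 1)}` — its balls `x + Λ_ℓ` cover `Λ_N ∩ {x₀ = 0}`
(`exists_net_mem_ball`), `#net ≤ (2⌊(N+ℓ)/(2ℓ+1)⌋+1)^d` (`card_net_le`), `netWidth_mul_le`, and a boundary fact
`exists_le_natAbs_of_mem_innerBoundary_box`. §2 the covering step `linkIn_faces_inter_posOnly_subset`: an open path of lattice
edges inside `Λ_N` from height `≤ -M` to height `≥ M` crosses the mid-plane inside some net ball `x + Λ_ℓ` and then leaves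
`x + Λ_K` through its inner vertex boundary (`ℓ ≤ K < M`; discrete intermediate values `GMStep.GMParams.exists_eq_of_reflTransGen` + first exit). §3 the FKG transfer at
the minimising net point `exists_net_pow_card_le`: `(1 - φ⁰_{Λ_N}(x + Λ_ℓ ↔ ∂(x + Λ_K) in Λ_N))^{#net} ≤
1 - φ⁰_{Λ_N}(S_bot ↔ S_top in Λ_N)` (iterated FKG for decreasing events, tree `fkLaw_prod_real_le_biInter_of_isLowerSet`);
recentring `fkLaw_box_real_linkIn_ball_le`: `φ⁰_{Λ_N}(x + Λ_ℓ ↔ ∂(x + Λ_K) in Λ_N) ≤ φ⁰_{Λ_{N'}}(Λ_ℓ ↔ ∂Λ_K in Λ_{N'})`,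
`x ∈ Λ_R`, `N' ≥ N + R` (translation invariance + free-domain monotonicity `fkLaw_real_le_of_subset`, Grimmett §4.3,
Lemma (4.13), (3.22)); `fkLaw_box_real_linkIn_mono` (a larger free box only helps the reach event).

## References

* F. Severo, *Slab percolation for the Ising model revisited*, ECP 29 (2024), arXiv:2312.06831, §2.1 Lemma 2.1. [Severo2024]
* G. Grimmett, *The Random-Cluster Model*, Springer 2006: Thm. (3.8)(b), (3.22), Lemma (4.13), (4.24), §4.3. [Grimmett2006]
* G. Grimmett, *Percolation*, 2nd ed. (1999), §1.4 (the events `A_n`, first exit). [GrimmettPercolation1999]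
-/

noncomputable section

open MeasureTheory Finset SimpleGraph
open scoped ENNReal Classical

namespace Summit.CriticalPhenomena.PercolationContinuityZ3.Theorems.FK

open Literature.Probability.Percolation Literature.Probability.LatticeModels
open Literature.Probability.Percolation.KozmaNitzan Literature.Probability.Percolation.GM
open Literature.Barriers.CriticalPhenomena

variable {d : ℕ}

/-! ### 1. Geometry: the mid-plane net of `Λ_{N+ℓ} ⊆ ℤ^{d+1}`, its cardinality, and two lattice facts -/

section

/-- **The mid-plane net covers the mid-plane**: every `w ∈ Λ_N` with `w₀ = 0` lies in the ball `x + Λ_ℓ` of a net point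
`x ∈ Λ_{N+ℓ}`, `x₀ = 0`, horizontal coordinates divisible by `2ℓ+1` (round to the nearest multiple of `2ℓ+1`).
[cite: Severo2024, §2.1 proof of Lemma 2.1 (cover the hyperplane by boxes Λ_ℓ(x_i))] -/
theorem exists_net_mem_ball {N ℓ : ℕ} {w : Site (d + 1)} (hw : w ∈ box (d + 1) N) (hw0 : w 0 = 0) :
    ∃ x ∈ (box (d + 1) (N + ℓ)).filter (fun x => x 0 = 0 ∧ ∀ i : Fin d, ((2 * ℓ + 1 : ℕ) : ℤ) ∣ x i.succ),
      w ∈ GM.ball x ℓ := by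
  set k : ℤ := ((2 * ℓ + 1 : ℕ) : ℤ) with hk
  have hk0 : 0 < k := by rw [hk]; exact_mod_cast Nat.succ_pos _
  set x : Site (d + 1) := fun j => if j = 0 then 0 else k * ((w j + ℓ) / k) with hx
  have hx0 : x 0 = 0 := by simp [hx]
  have hxs : ∀ j : Fin (d + 1), j ≠ 0 → x j = k * ((w j + ℓ) / k) := fun j hj => by simp [hx, hj]
  -- the rounding error: `w j - x j = (w j + ℓ) % k - ℓ ∈ [-ℓ, ℓ]`
  have hround : ∀ j : Fin (d + 1), j ≠ 0 → -(ℓ : ℤ) ≤ w j - x j ∧ w j - x j ≤ ℓ := by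
    intro j hj
    rw [hxs j hj]
    have h1 := Int.emod_nonneg (w j + ℓ) hk0.ne'
    have h2 := Int.emod_lt_of_pos (w j + ℓ) hk0
    have h3 := Int.emod_def (w j + ℓ) k
    have hk' : k = 2 * ℓ + 1 := by rw [hk]; push_cast; ring
    constructor <;> omega
  have hwN := mem_box.1 hw
  refine ⟨x, Finset.mem_filter.2 ⟨mem_box.2 fun j => ?_, hx0, fun i => ?_⟩, GM.mem_ball.2 fun j => ?_⟩
  · by_cases hj : j = 0
    · subst hj; rw [hx0]; constructor <;> omega
    · have h := hround j hj
      have h' := hwN j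
      constructor <;> push_cast <;> omega
  · rw [hxs i.succ (Fin.succ_ne_zero i)]
    exact dvd_mul_right k _
  · by_cases hj : j = 0
    · subst hj; rw [hx0, hw0]; constructor <;> omega
    · exact hround j hj

/-- **Cardinality of the mid-plane net**: `≤ (2J+1)^d` points, `J = ⌊(N+ℓ)/(2ℓ+1)⌋` (divide the horizontal coordinates
by `2ℓ+1`: an injection into `Λ_J ⊆ ℤ^d`). [cite: Severo2024, §2.1 proof of Lemma 2.1 (m ≤ C''(L/ℓ)^{d-1} boxes)] -/
theorem card_net_le (N ℓ : ℕ) :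
    ((box (d + 1) (N + ℓ)).filter (fun x => x 0 = 0 ∧ ∀ i : Fin d, ((2 * ℓ + 1 : ℕ) : ℤ) ∣ x i.succ)).card ≤
      (2 * ((N + ℓ) / (2 * ℓ + 1)) + 1) ^ d := by
  set k : ℤ := ((2 * ℓ + 1 : ℕ) : ℤ) with hk
  have hk0 : 0 < k := by rw [hk]; exact_mod_cast Nat.succ_pos _
  set J : ℕ := (N + ℓ) / (2 * ℓ + 1) with hJ
  rw [← card_box d J]
  refine Finset.card_le_card_of_injOn (fun x : Site (d + 1) => fun i : Fin d => x i.succ / k) ?_ ?_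
  · intro x hx
    rw [Finset.mem_coe, Finset.mem_filter] at hx
    obtain ⟨hxbox, -, hdvd⟩ := hx
    rw [Finset.mem_coe, mem_box]
    intro i
    obtain ⟨j, hj⟩ := hdvd i
    have hxi := (mem_box.1 hxbox) i.succ
    show -(J : ℤ) ≤ x i.succ / k ∧ x i.succ / k ≤ J
    rw [hj, Int.mul_ediv_cancel_left _ hk0.ne']
    -- `|k * j| ≤ N + ℓ` forces `|j| ≤ J`
    have hJ' : (J : ℤ) = ((N + ℓ : ℕ) : ℤ) / k := by rw [hJ, hk]; exact_mod_cast (Int.natCast_div _ _)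
    have habs : |j| * k ≤ ((N + ℓ : ℕ) : ℤ) := by
      rw [hj] at hxi
      push_cast at hxi
      have : |k * j| ≤ ((N + ℓ : ℕ) : ℤ) := by
        rw [abs_le]; push_cast; constructor <;> linarith [hxi.1, hxi.2]
      rwa [abs_mul, abs_of_pos hk0, mul_comm] at this
    have hjJ : |j| ≤ (J : ℤ) := by rw [hJ']; exact (Int.le_ediv_iff_mul_le hk0).2 habs
    constructor <;> linarith [abs_le.1 hjJ |>.1, abs_le.1 hjJ |>.2, hjJ]
  · intro x hx y hy hxy
    rw [Finset.mem_coe, Finset.mem_filter] at hx hy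
    funext j
    refine Fin.cases ?_ (fun i => ?_) j
    · rw [hx.2.1, hy.2.1]
    · have h := congr_fun hxy i
      simp only at h
      rw [← Int.mul_ediv_cancel' (hx.2.2 i), ← Int.mul_ediv_cancel' (hy.2.2 i), h]

/-- The net is nonempty: the origin is a net point. [folklore] -/
theorem zero_mem_net (N ℓ : ℕ) :
    (0 : Site (d + 1)) ∈ (box (d + 1) (N + ℓ)).filter
      (fun x => x 0 = 0 ∧ ∀ i : Fin d, ((2 * ℓ + 1 : ℕ) : ℤ) ∣ x i.succ) :=
  Finset.mem_filter.2 ⟨mem_box.2 fun i => ⟨by simp, by simp; positivity⟩, rfl, fun i => by simp⟩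

/-- The net-size bound behind the rate: `(2⌊(N+ℓ)/(2ℓ+1)⌋+1)·ℓ ≤ N + 2ℓ`. [folklore] -/
theorem netWidth_mul_le (N ℓ : ℕ) : (2 * ((N + ℓ) / (2 * ℓ + 1)) + 1) * ℓ ≤ N + 2 * ℓ := by
  have h := Nat.div_mul_le_self (N + ℓ) (2 * ℓ + 1)
  set J := (N + ℓ) / (2 * ℓ + 1)
  nlinarith [h, Nat.zero_le J]

/-- A vertex of the inner vertex boundary of `Λ_K` has a coordinate of modulus `≥ K`. [folklore] -/
theorem exists_le_natAbs_of_mem_innerBoundary_box {K : ℕ} {z : Site d}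
    (hz : z ∈ innerBoundary (zdGraph d) (box d K)) : ∃ i, (K : ℤ) ≤ |z i| := by
  rw [mem_innerBoundary_iff] at hz
  obtain ⟨-, y, hy, hadj⟩ := hz
  rw [mem_box] at hy
  push Not at hy
  obtain ⟨i, hi⟩ := hy
  refine ⟨i, ?_⟩
  obtain ⟨j, h | h⟩ := (zdGraph_adj_iff z y).1 hadj
  · rw [h] at hi
    by_cases hij : i = j
    · subst hij; simp at hi; rw [le_abs]; omega
    · simp [hij] at hi; rw [le_abs]; omega
  · have hzi : z i = y i + (Pi.single j (1 : ℤ) : Site d) i := by rw [h]; rfl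
    by_cases hij : i = j
    · subst hij; simp at hzi; rw [le_abs]; omega
    · simp [hij] at hzi; rw [le_abs]; omega

end

/-! ### 2. Paths: a face-to-face open path in `Λ_N` makes some net ball reach its `K`-sphere -/

section

/-- An open pair of nonzero lattice weight is a lattice edge: its endpoints differ by at most one in every coordinate.
[folklore] -/
theorem sub_le_one_of_openGraph_adj_of_posOnly {p : unitInterval} {ω : BondConfig (Site (d + 1))}
    (hpos : ω ∈ LData.PosOnly (lattW (d + 1) p)) {a b : Site (d + 1)} (hab : (openGraph ω).Adj a b) :
    (zdGraph (d + 1)).Adj a b ∧ ∀ i, a i - b i ≤ 1 ∧ b i - a i ≤ 1 := by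
  rw [openGraph_adj] at hab
  have hadj : (zdGraph (d + 1)).Adj a b := by
    have hne := hpos _ hab.1
    by_contra hcon
    exact hne (by rw [lattW_mk, if_neg hcon])
  refine ⟨hadj, fun i => ?_⟩
  obtain ⟨j, h | h⟩ := (zdGraph_adj_iff a b).1 hadj
  · rw [h]
    by_cases hij : i = j
    · subst hij; simp
    · simp [hij]
  · rw [h]
    by_cases hij : i = j
    · subst hij; simp
    · simp [hij]

/-- **The covering step** (Severo 2024, proof of Lemma 2.1: "`⋂_i {Λ_ℓ(x_i) ↮ Λ_{δ'L}(x_i)} ⊂ {∂^bot R ↮ ∂^top R}`"):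
if a set `S_bot` (heights `≤ -M`) is joined inside `Λ_N` to a set `S_top` (heights `≥ M`) by an open path of lattice edges,
then for some net point `x` the ball `x + Λ_ℓ` is joined inside `Λ_N` to the inner vertex boundary of `x + Λ_K`
(`ℓ ≤ K < M`: the path crosses the mid-plane at some `w ∈ x + Λ_ℓ`, then climbs to height `M > K`).
[cite: Severo2024, §2.1 proof of Lemma 2.1] -/
theorem linkIn_faces_inter_posOnly_subset {p : unitInterval} {N M ℓ K : ℕ} (hℓK : ℓ ≤ K) (hKM : K < M)
    {Sbot Stop : Finset (Site (d + 1))} (hbot : ∀ u ∈ Sbot, u 0 ≤ -(M : ℤ)) (htop : ∀ v ∈ Stop, (M : ℤ) ≤ v 0) :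
    linkIn (↑(box (d + 1) N) : Set (Site (d + 1))) Sbot Stop ∩ LData.PosOnly (lattW (d + 1) p) ⊆
      ⋃ x ∈ (box (d + 1) (N + ℓ)).filter (fun x => x 0 = 0 ∧ ∀ i : Fin d, ((2 * ℓ + 1 : ℕ) : ℤ) ∣ x i.succ),
        linkIn (↑(box (d + 1) N) : Set (Site (d + 1))) (GM.ball x ℓ)
          (innerBoundary (zdGraph (d + 1)) (GM.ball x K)) := by
  rintro ω ⟨⟨u, hu, v, hv, huv⟩, hpos⟩
  simp only [Set.mem_iUnion, exists_prop]
  rw [DCT16.mem_openConnIn_iff_pathIn] at huv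
  -- the reversed path `v → u` inside `Λ_N`
  have hvu : PathIn (openGraph ω) (↑(box (d + 1) N) : Set (Site (d + 1))) v u := huv.symm
  -- height function `g a = (M - a₀)⁺`: `0` at `v`, `≥ M` at `u`, Lipschitz along open lattice steps
  set g : Site (d + 1) → ℕ := fun a => ((M : ℤ) - a 0).toNat with hg
  have hstep : ∀ a b : Site (d + 1),
      ((openGraph ω).Adj a b ∧ b ∈ (↑(box (d + 1) N) : Set (Site (d + 1)))) → g b ≤ g a + 1 := by
    rintro a b ⟨hab, -⟩
    have h := (sub_le_one_of_openGraph_adj_of_posOnly hpos hab).2 0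
    simp only [hg]
    omega
  have hgv : g v ≤ M := by have := htop v hv; simp only [hg]; omega
  have hgu : M ≤ g u := by have := hbot u hu; simp only [hg]; omega
  obtain ⟨w, hvw, hgw⟩ := GMStep.GMParams.exists_eq_of_reflTransGen g hstep hvu.2 M hgv hgu
  have hw0 : w 0 = 0 := by
    simp only [hg] at hgw
    have hM : 0 < M := by omega
    omega
  -- `w ∈ Λ_N`, and the path `w → v`
  have hpath_vw : PathIn (openGraph ω) (↑(box (d + 1) N) : Set (Site (d + 1))) v w := ⟨hvu.1, hvw⟩
  have hwN : w ∈ box (d + 1) N := Finset.mem_coe.1 hpath_vw.right_mem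
  have hpath_wv := hpath_vw.symm
  -- a net point `x` with `w ∈ x + Λ_ℓ ⊆ x + Λ_K`, while `v ∉ x + Λ_K`
  obtain ⟨x, hx, hwx⟩ := exists_net_mem_ball (ℓ := ℓ) hwN hw0
  have hx0 : x 0 = 0 := (Finset.mem_filter.1 hx).2.1
  have hwK : w ∈ (↑(GM.ball x K) : Set (Site (d + 1))) := by
    rw [Finset.mem_coe, GM.mem_ball]
    intro i
    have := (GM.mem_ball.1 hwx) i
    constructor <;> omega
  have hvK : v ∉ (↑(GM.ball x K) : Set (Site (d + 1))) := by
    intro h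
    have h0 := (GM.mem_ball.1 (Finset.mem_coe.1 h)) 0
    have := htop v hv
    rw [hx0] at h0
    omega
  -- first exit of the path `w → v` from `x + Λ_K`
  obtain ⟨a, c, ha, hc, -, hac, hpa⟩ := hpath_wv.exit hwK hvK
  have hadj : (zdGraph (d + 1)).Adj a c := (sub_le_one_of_openGraph_adj_of_posOnly hpos hac).1
  refine ⟨x, hx, w, hwx, a, ?_, ?_⟩
  · rw [mem_innerBoundary_iff]
    exact ⟨Finset.mem_coe.1 ha, c, fun h => hc (Finset.mem_coe.2 h), hadj⟩
  · rw [DCT16.mem_openConnIn_iff_pathIn]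
    exact hpa.mono Set.inter_subset_right

end

/-! ### 3. The FKG transfer at a net point, recentring, free-domain monotonicity -/

section

variable {q : ℝ}

/-- **FKG transfer at a net point** (`q ≥ 1`): under the FREE measure `φ⁰_{Λ_N,p,q} = fkLaw Λ_N (lattW p) q` the
complements `D_x = {x + Λ_ℓ ↮ ∂(x + Λ_K) in Λ_N}` over the net are decreasing, so by FKG `∏_x φ(D_x) ≤ φ(⋂_x D_x) ≤
φ(S_bot ↮ S_top in Λ_N)` (covering step; a.s. open pairs are lattice edges); at the minimising net point `x`:
`(1 - φ(x + Λ_ℓ ↔ ∂(x + Λ_K) in Λ_N))^{#net} ≤ 1 - φ(S_bot ↔ S_top in Λ_N)`. [cite: Severo2024, §2.1 proof of Lemma 2.1 (FKG ⟹ some box i₀)] [cite: Grimmett2006, Thm. (3.8)(b)] -/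
theorem exists_net_pow_card_le (hq : 1 ≤ q) (p : unitInterval) {N M ℓ K : ℕ} (hℓK : ℓ ≤ K) (hKM : K < M)
    {Sbot Stop : Finset (Site (d + 1))} (hbot : ∀ u ∈ Sbot, u 0 ≤ -(M : ℤ)) (htop : ∀ v ∈ Stop, (M : ℤ) ≤ v 0) :
    ∃ x ∈ (box (d + 1) (N + ℓ)).filter (fun x => x 0 = 0 ∧ ∀ i : Fin d, ((2 * ℓ + 1 : ℕ) : ℤ) ∣ x i.succ),
      (1 - (fkLaw (box (d + 1) N) (lattW (d + 1) p) q).real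
          (linkIn (↑(box (d + 1) N)) (GM.ball x ℓ) (innerBoundary (zdGraph (d + 1)) (GM.ball x K)))) ^
        ((box (d + 1) (N + ℓ)).filter
          (fun x => x 0 = 0 ∧ ∀ i : Fin d, ((2 * ℓ + 1 : ℕ) : ℤ) ∣ x i.succ)).card ≤
      1 - (fkLaw (box (d + 1) N) (lattW (d + 1) p) q).real
        (linkIn (↑(box (d + 1) N)) Sbot Stop) := by
  have hq0 : 0 < q := one_pos.trans_le hq
  set μ := fkLaw (box (d + 1) N) (lattW (d + 1) p) q with hμ
  haveI : IsProbabilityMeasure μ := isProbabilityMeasure_fkLaw _ _ hq0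
  set S := (box (d + 1) (N + ℓ)).filter
    (fun x => x 0 = 0 ∧ ∀ i : Fin d, ((2 * ℓ + 1 : ℕ) : ℤ) ∣ x i.succ) with hS
  set E : Site (d + 1) → Set (BondConfig (Site (d + 1))) := fun x =>
    linkIn (↑(box (d + 1) N)) (GM.ball x ℓ) (innerBoundary (zdGraph (d + 1)) (GM.ball x K)) with hE
  have hEm : ∀ x, MeasurableSet (E x) := fun x => measurableSet_linkIn _ _ _
  have hEu : ∀ x, IsUpperSet (E x) := fun x => isUpperSet_linkIn_site _ _ _
  -- the net point minimising `μ (E x)ᶜ`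
  obtain ⟨x₀, hx₀, hmin⟩ := S.exists_min_image (fun x => μ.real (E x)ᶜ) ⟨0, zero_mem_net N ℓ⟩
  refine ⟨x₀, hx₀, ?_⟩
  have hcompl : ∀ x, μ.real (E x)ᶜ = 1 - μ.real (E x) := fun x => probReal_compl_eq_one_sub (hEm x)
  show (1 - μ.real (E x₀)) ^ S.card ≤ _
  rw [← hcompl]
  calc μ.real (E x₀)ᶜ ^ S.card = ∏ _x ∈ S, μ.real (E x₀)ᶜ := (Finset.prod_const _).symm
    _ ≤ ∏ x ∈ S, μ.real (E x)ᶜ :=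
        Finset.prod_le_prod (fun _ _ => measureReal_nonneg) fun x hx => hmin x hx
    _ ≤ μ.real (⋂ x ∈ S, (E x)ᶜ) :=
        fkLaw_prod_real_le_biInter_of_isLowerSet _ _ hq S (fun x => (E x)ᶜ) (fun x => (hEu x).compl)
          fun x => (hEm x).compl
    _ ≤ μ.real ((linkIn (↑(box (d + 1) N)) Sbot Stop)ᶜ ∪ (LData.PosOnly (lattW (d + 1) p))ᶜ) := by
        refine measureReal_mono (fun ω hω => ?_) (measure_ne_top _ _)
        by_contra hcon
        simp only [Set.mem_union, Set.mem_compl_iff, not_or, not_not] at hcon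
        have hmem := linkIn_faces_inter_posOnly_subset (p := p) (N := N) hℓK hKM hbot htop ⟨hcon.1, hcon.2⟩
        simp only [Set.mem_iUnion, exists_prop] at hmem
        obtain ⟨x, hxS, hωx⟩ := hmem
        exact (Set.mem_iInter₂.1 hω) x hxS hωx
    _ ≤ μ.real (linkIn (↑(box (d + 1) N)) Sbot Stop)ᶜ + μ.real (LData.PosOnly (lattW (d + 1) p))ᶜ :=
        measureReal_union_le _ _
    _ = μ.real (linkIn (↑(box (d + 1) N)) Sbot Stop)ᶜ := by
        rw [hμ, KNFree.real_fkLaw_compl_posOnly_eq_zero hq, add_zero]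
    _ = 1 - μ.real (linkIn (↑(box (d + 1) N)) Sbot Stop) :=
        probReal_compl_eq_one_sub (measurableSet_linkIn _ _ _)

/-- The inner vertex boundary of a translated box is the translate of the inner vertex boundary. [folklore] -/
theorem innerBoundary_ball_eq_image (x : Site (d + 1)) (K : ℕ) :
    innerBoundary (zdGraph (d + 1)) (GM.ball x K) =
      (innerBoundary (zdGraph (d + 1)) (box (d + 1) K)).image (· + x) := by
  ext z
  simp only [mem_innerBoundary_iff, Finset.mem_image, GM.ball]
  constructor
  · rintro ⟨⟨z', hz', rfl⟩, y, hy, hadj⟩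
    refine ⟨z', ⟨hz', y - x, fun hy' => hy ⟨y - x, hy', sub_add_cancel y x⟩, ?_⟩, rfl⟩
    have h := zdGraph_adj_shift_iff x z' (y - x)
    simp only [Site.shift_apply, sub_add_cancel] at h
    exact h.1 hadj
  · rintro ⟨z', ⟨hz', y, hy, hadj⟩, rfl⟩
    refine ⟨⟨z', hz', rfl⟩, y + x, ?_, ?_⟩
    · rintro ⟨y', hy', hyy⟩
      obtain rfl : y' = y := add_right_cancel hyy
      exact hy hy'
    · have h := zdGraph_adj_shift_iff x z' y
      simp only [Site.shift_apply] at h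
      exact h.2 hadj

/-- **Recentring** (`q ≥ 1`): `φ⁰_{Λ_N}(x + Λ_ℓ ↔ ∂(x + Λ_K) in Λ_N) ≤ φ⁰_{Λ_{N'}}(Λ_ℓ ↔ ∂Λ_K in Λ_{N'})` for `x ∈ Λ_R`,
`N' ≥ N + R` — translate by `-x` (`Λ_N - x ⊆ Λ_{N'}`) and enlarge the free region (Grimmett (4.13) with (3.22)).
[cite: Severo2024, §2.1 proof of Lemma 2.1 (comparison between boundary conditions)] [cite: Grimmett2006, §4.3, Lemma (4.13), eq. (3.22)] -/
theorem fkLaw_box_real_linkIn_ball_le (hq : 1 ≤ q) (p : unitInterval) {N R N' ℓ K : ℕ} (hN' : N + R ≤ N')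
    {x : Site (d + 1)} (hx : x ∈ box (d + 1) R) :
    (fkLaw (box (d + 1) N) (lattW (d + 1) p) q).real
        (linkIn (↑(box (d + 1) N)) (GM.ball x ℓ) (innerBoundary (zdGraph (d + 1)) (GM.ball x K))) ≤
      (fkLaw (box (d + 1) N') (lattW (d + 1) p) q).real
        (linkIn (↑(box (d + 1) N')) (box (d + 1) ℓ) (innerBoundary (zdGraph (d + 1)) (box (d + 1) K))) := by
  have hq0 : 0 < q := one_pos.trans_le hq
  set Λ' : Finset (Site (d + 1)) := (box (d + 1) N).image (· - x) with hΛ'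
  have hΛ'N : Λ'.image (· + x) = box (d + 1) N := by
    rw [hΛ', Finset.image_image]
    convert Finset.image_id (s := box (d + 1) N) using 2
    funext z
    simp
  have hsub : Λ' ⊆ box (d + 1) N' := by
    intro z hz
    rw [hΛ', Finset.mem_image] at hz
    obtain ⟨y, hy, rfl⟩ := hz
    rw [mem_box] at hy hx ⊢
    intro i
    have h1 := hy i
    have h2 := hx i
    simp only [Pi.sub_apply]
    constructor <;> omega
  have htrans : (fkLaw (box (d + 1) N) (lattW (d + 1) p) q).real
        (linkIn (↑(box (d + 1) N)) (GM.ball x ℓ) (innerBoundary (zdGraph (d + 1)) (GM.ball x K))) =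
      (fkLaw Λ' (lattW (d + 1) p) q).real
        (linkIn (↑Λ') (box (d + 1) ℓ) (innerBoundary (zdGraph (d + 1)) (box (d + 1) K))) := by
    rw [innerBoundary_ball_eq_image, GM.ball, ← hΛ'N,
      fkLaw_image_add_real_preimage Λ' x (lattW (d + 1) p) hq0 (measurableSet_linkIn _ _ _),
      lattW_comp_shift, relabel_shift_preimage_linkIn]
  rw [htrans]
  calc (fkLaw Λ' (lattW (d + 1) p) q).real
        (linkIn (↑Λ') (box (d + 1) ℓ) (innerBoundary (zdGraph (d + 1)) (box (d + 1) K)))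
      ≤ (fkLaw (box (d + 1) N') (lattW (d + 1) p) q).real
          (linkIn (↑Λ') (box (d + 1) ℓ) (innerBoundary (zdGraph (d + 1)) (box (d + 1) K))) :=
        fkLaw_real_le_of_subset hsub _ hq (isUpperSet_linkIn_site _ _ _) (measurableSet_linkIn _ _ _)
    _ ≤ _ := by
        haveI : IsProbabilityMeasure (fkLaw (box (d + 1) N') (lattW (d + 1) p) q) :=
          isProbabilityMeasure_fkLaw _ _ hq0
        exact measureReal_mono (linkIn_mono (Finset.coe_subset.2 hsub) le_rfl le_rfl) (measure_ne_top _ _)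

/-- **Bulk reach is monotone in the size of the free box** (`c ≤ c'`): reaching `∂Λ_n` from `Λ_m` inside the free box
`Λ_{cn}` is at most as likely as inside `Λ_{c'n}` (free-domain monotonicity) — the family WEAKENS as `c` grows; `c = 1` is
boundary reach. [cite: Grimmett2006, Lemma (4.13), Thm. (3.21) eq. (3.22), Thm. (4.19)(a) eq. (4.24)] -/
theorem fkLaw_box_real_linkIn_mono (hq : 1 ≤ q) (p : unitInterval) {c c' n m : ℕ} (hcc : c ≤ c') :
    (fkLaw (box d (c * n)) (lattW d p) q).real
        (linkIn (↑(box d (c * n))) (box d m) (innerBoundary (zdGraph d) (box d n))) ≤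
      (fkLaw (box d (c' * n)) (lattW d p) q).real
        (linkIn (↑(box d (c' * n))) (box d m) (innerBoundary (zdGraph d) (box d n))) := by
  have hq0 : 0 < q := one_pos.trans_le hq
  have hsub : box d (c * n) ⊆ box d (c' * n) := box_mono d (Nat.mul_le_mul_right n hcc)
  haveI : IsProbabilityMeasure (fkLaw (box d (c' * n)) (lattW d p) q) := isProbabilityMeasure_fkLaw _ _ hq0
  calc _ ≤ (fkLaw (box d (c' * n)) (lattW d p) q).real
          (linkIn (↑(box d (c * n))) (box d m) (innerBoundary (zdGraph d) (box d n))) :=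
        fkLaw_real_le_of_subset hsub _ hq (isUpperSet_linkIn_site _ _ _) (measurableSet_linkIn _ _ _)
    _ ≤ _ := measureReal_mono (linkIn_mono (Finset.coe_subset.2 hsub) le_rfl le_rfl) (measure_ne_top _ _)

end

end Summit.CriticalPhenomena.PercolationContinuityZ3.Theorems.FK

end
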